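import Summits.ValiantsHypothesis.ValiantsHypothesis.Theorems.SymPencilPerFourInnerRankSlotKernel
import Summits.ValiantsHypothesis.ValiantsHypothesis.Theorems.SymPencilPerFourInnerRankConeFour

/-!
# Route `SymPencil` — inner rank of the `2 | 2` row split of `per_4`: the mixed type II of the
# `a`-slot kernel is impossible (`--supports` stmt-ValiantsHypothesis-5674 `SdcSuperquadratic`;
# (8,8) column of the size tables, isotropic-kernel route, memo `NOTE-p6g15-5674-IR12-reduction.md` §2)

For a joint family `Σ_r c_r t_r((a,b),(y₂,y₃))² = per (a; b; y₂; y₃)` with `|ι| ≤ 11` squares and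
non-zero weights, fix `a` with non-zero coordinates and let `K_a` be the kernel of the `a`-slot
`y ↦ (t_r((a,0),y))_r`.

**Theorem** (`false_of_mixedII`).  It is impossible that, for some column index `d`, all columns
`j ≠ d` of the `y₂`-block vanish on the `a`-parts (`t_r((a',0),(e_j,0)) = 0` for all `a'`, `r`,
`j ≠ d` — the consequence of a "mixed type II" kernel extracted by coefficient comparison) while
`K_a` contains a vector with non-zero `y₃`-part: then `K_a ⊇ {(y₂,0) : (y₂)_d = 0} ⊕ K·y` has
dimension `≥ 4` and is neither contained in `Y₂ ⊕ 0` nor in `0 ⊕ Y₃`, contradicting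
`SymPencilPerFourInnerRankConeFour.fst_or_snd_of_four_le_diag` (the kernel lies in the common
isotropic cone by `SymPencilPerFourInnerRankSlotKernel.ker_slotA_cone`).

Honest framing: one case of a CONDITIONAL reduction of the cells `(8,8,10)`, `(8,8,11)`; the cells
stay open; the window `27 ≤ sdc(per_4) ≤ 29`, the crux and `VP ≠ VNP` are untouched.  No
definitions, no named facts. [folklore]
-/

noncomputable section

-- single-conjunct layout: Sub = Summit, duplicated namespace component intended
set_option linter.dupNamespace false

namespace Summit.ValiantsHypothesis.ValiantsHypothesis.Theorems.SymPencilPerFourInnerRankMixedKillTwo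

open Matrix Finset Module
open Summit.ValiantsHypothesis.ValiantsHypothesis.Theorems.SymPencilPerFourInnerRankSlotKernel
open Summit.ValiantsHypothesis.ValiantsHypothesis.Theorems.SymPencilPerFourInnerRankConeFour

variable {K : Type*} [Field K] {ι : Type*} [Fintype ι]

omit [Fintype ι] in
/-- **Column extraction for the mixed type II.**  If `t_r((a,0),(a_p e_p - a_q e_q, 0)) = 0` and
`t_r((a,0),(a_q e_q - a_i e_i, 0)) = 0` for all `a` (`p, q, i` pairwise distinct), then the columns
`p, q, i` of the `y₂`-block vanish on all `a`-parts: `t_r((a',0),(e_j,0)) = 0` for `j ∈ {p,q,i}`.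
[folklore] -/
theorem cols_of_typeII (t : ι → (((Fin 4 → K) × (Fin 4 → K)) →ₗ[K] ((Fin 4 → K) × (Fin 4 → K)) →ₗ[K] K))
    (p q i : Fin 4) (hpq : p ≠ q) (hpi : p ≠ i) (hqi : q ≠ i)
    (h1 : ∀ (a : Fin 4 → K) r, t r (a, 0) (a p • Pi.single p 1 - a q • Pi.single q 1, 0) = 0)
    (h2 : ∀ (a : Fin 4 → K) r, t r (a, 0) (a q • Pi.single q 1 - a i • Pi.single i 1, 0) = 0) :
    ∀ j : Fin 4, (j = p ∨ j = q ∨ j = i) → ∀ (a' : Fin 4 → K) r,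
      t r (a', 0) (Pi.single j 1, 0) = 0 := by
  -- abbreviation for the `a`-part matrix entries `m k j = t((e_k,0),(e_j,0))`
  have hlin : ∀ (a' : Fin 4 → K) (y : (Fin 4 → K) × (Fin 4 → K)) r,
      t r (a', 0) y = ∑ k, a' k * t r (Pi.single k 1, 0) y := fun a' y r => by
    have ha' : ((a', (0 : Fin 4 → K)) : (Fin 4 → K) × (Fin 4 → K)) =
        ∑ k, a' k • ((Pi.single k (1 : K), (0 : Fin 4 → K)) : (Fin 4 → K) × (Fin 4 → K)) := by
      ext j
      · simp [Pi.single_apply, Fin.sum_univ_four]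
        fin_cases j <;> simp
      · simp [Prod.snd_sum]
    rw [ha', map_sum, LinearMap.sum_apply]
    exact Finset.sum_congr rfl fun k _ => by rw [map_smul, LinearMap.smul_apply, smul_eq_mul]
  -- generic extraction from an identity of the shape `h1`
  have extract : ∀ (p q : Fin 4), p ≠ q →
      (∀ (a : Fin 4 → K) r, t r (a, 0) (a p • Pi.single p 1 - a q • Pi.single q 1, 0) = 0) →
      (∀ k : Fin 4, k ≠ q → ∀ r, t r (Pi.single k 1, 0) (Pi.single p 1, 0) = 0) ∧
      (∀ k : Fin 4, k ≠ p → ∀ r, t r (Pi.single k 1, 0) (Pi.single q 1, 0) = 0) ∧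
      (∀ r, t r (Pi.single q 1, 0) (Pi.single p 1, 0) = t r (Pi.single p 1, 0) (Pi.single q 1, 0)) := by
    intro p q hpq h
    -- the vectors `(e_p,0)`, `(e_q,0)` as elements of `K⁴ × K⁴`
    have vsub : ∀ (x y : Fin 4 → K), ((x - y, (0 : Fin 4 → K)) : (Fin 4 → K) × (Fin 4 → K)) =
        (x, 0) - (y, 0) := fun x y => by simp
    have vadd : ∀ (x y : Fin 4 → K), ((x + y, (0 : Fin 4 → K)) : (Fin 4 → K) × (Fin 4 → K)) =
        (x, 0) + (y, 0) := fun x y => by simp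
    have vsmul : ∀ (s : K) (x : Fin 4 → K), ((s • x, (0 : Fin 4 → K)) : (Fin 4 → K) × (Fin 4 → K)) =
        s • (x, 0) := fun s x => by simp
    -- expand `h a` bilinearly: `a_p M(a,p) - a_q M(a,q) = 0` with `M(a,j) = t((a,0),(e_j,0))`
    have hexp : ∀ (a : Fin 4 → K) r,
        a p * t r (a, 0) (Pi.single p 1, 0) - a q * t r (a, 0) (Pi.single q 1, 0) = 0 := by
      intro a r
      have := h a r
      rw [vsub, map_sub, vsmul, vsmul, map_smul, map_smul, smul_eq_mul, smul_eq_mul] at this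
      exact this
    -- rows: `t((x+y,0), v) = t((x,0),v) + t((y,0),v)`
    have hrow : ∀ (x y : Fin 4 → K) (v : (Fin 4 → K) × (Fin 4 → K)) r,
        t r (x + y, 0) v = t r (x, 0) v + t r (y, 0) v := fun x y v r => by
      rw [vadd, map_add, LinearMap.add_apply]
    have hp : ∀ r, t r (Pi.single p 1, 0) (Pi.single p 1, 0) = 0 := fun r => by
      have := hexp (Pi.single p 1) r
      rw [Pi.single_eq_same, Pi.single_eq_of_ne hpq.symm, one_mul, zero_mul, sub_zero] at this
      exact this
    have hq : ∀ r, t r (Pi.single q 1, 0) (Pi.single q 1, 0) = 0 := fun r => by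
      have := hexp (Pi.single q 1) r
      rw [Pi.single_eq_same, Pi.single_eq_of_ne hpq, zero_mul, one_mul, zero_sub, neg_eq_zero]
        at this
      exact this
    have hkp : ∀ k : Fin 4, k ≠ p → k ≠ q → ∀ r, t r (Pi.single k 1, 0) (Pi.single p 1, 0) = 0 := by
      intro k hkp hkq r
      have h' := hexp (Pi.single k 1 + Pi.single p 1) r
      simp only [Pi.add_apply, Pi.single_eq_of_ne (Ne.symm hkp), Pi.single_eq_same,
        Pi.single_eq_of_ne (Ne.symm hkq), Pi.single_eq_of_ne hpq.symm, zero_add, add_zero, one_mul,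
        zero_mul, sub_zero, hrow, hp r] at h'
      exact h'
    have hkq : ∀ k : Fin 4, k ≠ p → k ≠ q → ∀ r, t r (Pi.single k 1, 0) (Pi.single q 1, 0) = 0 := by
      intro k hkp hkq r
      have h' := hexp (Pi.single k 1 + Pi.single q 1) r
      simp only [Pi.add_apply, Pi.single_eq_of_ne (Ne.symm hkp), Pi.single_eq_of_ne hpq,
        Pi.single_eq_of_ne (Ne.symm hkq), Pi.single_eq_same, zero_add, add_zero, zero_mul,
        one_mul, zero_sub, hrow, hq r] at h'
      linear_combination (-1 : K) * h'
    have hsym : ∀ r, t r (Pi.single q 1, 0) (Pi.single p 1, 0) = t r (Pi.single p 1, 0) (Pi.single q 1, 0) := by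
      intro r
      have h' := hexp (Pi.single p 1 + Pi.single q 1) r
      simp only [Pi.add_apply, Pi.single_eq_same, Pi.single_eq_of_ne hpq,
        Pi.single_eq_of_ne hpq.symm, add_zero, zero_add, one_mul, hrow, hp r, hq r] at h'
      linear_combination h'
    refine ⟨fun k hk r => ?_, fun k hk r => ?_, hsym⟩
    · by_cases hkp' : k = p
      · rw [hkp']; exact hp r
      · exact hkp k hkp' hk r
    · by_cases hkq' : k = q
      · rw [hkq']; exact hq r
      · exact hkq k hk hkq' r
  obtain ⟨hp1, hq1, hs1⟩ := extract p q hpq h1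
  obtain ⟨hq2, hi2, hs2⟩ := extract q i hqi h2
  -- column q vanishes entirely, hence columns p and i as well
  have colq : ∀ k r, t r (Pi.single k 1, 0) (Pi.single q 1, 0) = 0 := fun k r => by
    by_cases hk : k = p
    · rw [hk]; exact hq2 p hpi r
    · exact hq1 k hk r
  have colp : ∀ k r, t r (Pi.single k 1, 0) (Pi.single p 1, 0) = 0 := fun k r => by
    by_cases hk : k = q
    · rw [hk, hs1 r]; exact colq p r
    · exact hp1 k hk r
  have coli : ∀ k r, t r (Pi.single k 1, 0) (Pi.single i 1, 0) = 0 := fun k r => by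
    by_cases hk : k = q
    · rw [hk, ← hs2 r]; exact colq i r
    · exact hi2 k hk r
  intro j hj a' r
  rw [hlin]
  refine Finset.sum_eq_zero fun k _ => ?_
  rcases hj with rfl | rfl | rfl
  · rw [colp, mul_zero]
  · rw [colq, mul_zero]
  · rw [coli, mul_zero]

/-- **Mixed type II of the `a`-slot kernel is impossible.**  See the module docstring.
[folklore] -/
theorem false_of_mixedII [CharZero K] [DecidableEq ι] (hι : Fintype.card ι ≤ 11)
    (c : ι → K) (hc : ∀ r, c r ≠ 0)
    (t : ι → (((Fin 4 → K) × (Fin 4 → K)) →ₗ[K] ((Fin 4 → K) × (Fin 4 → K)) →ₗ[K] K))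
    (hJ : ∀ a b y₂ y₃ : Fin 4 → K,
      ∑ r, c r * (t r (a, b) (y₂, y₃)) ^ 2 = (Matrix.of ![a, b, y₂, y₃]).permanent)
    (a : Fin 4 → K) (ha : ∀ i, a i ≠ 0) (d : Fin 4)
    (hcols : ∀ j : Fin 4, j ≠ d → ∀ (a' : Fin 4 → K) r, t r (a', 0) (Pi.single j 1, 0) = 0)
    (hmix : ∃ y ∈ LinearMap.ker (LinearMap.pi fun r => t r (a, 0)), y.2 ≠ 0) : False := by
  set W := LinearMap.ker (LinearMap.pi fun r => t r (a, 0)) with hW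
  have _h3 := three_le_finrank_ker_slotA hι c hc t hJ a
  obtain ⟨y, hy, hy2⟩ := hmix
  -- `(e_j, 0) ∈ W` for `j ≠ d`
  have hmem : ∀ j : Fin 4, j ≠ d → ((Pi.single j (1 : K), (0 : Fin 4 → K)) :
      (Fin 4 → K) × (Fin 4 → K)) ∈ W := by
    intro j hj
    rw [hW, LinearMap.mem_ker]
    ext r
    rw [LinearMap.pi_apply, Pi.zero_apply]
    exact hcols j hj a r
  -- four independent vectors in `W`
  obtain ⟨i₀, hi₀⟩ : ∃ i, y.2 i ≠ 0 := by
    by_contra h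
    push Not at h
    exact hy2 (funext h)
  let f : Fin 4 → ((Fin 4 → K) × (Fin 4 → K)) :=
    Fin.snoc (fun i : Fin 3 => (Pi.single (d.succAbove i) (1 : K), (0 : Fin 4 → K))) y
  have hf_last : f (Fin.last 3) = y := Fin.snoc_last _ _
  have hf_cast : ∀ i : Fin 3, f (Fin.castSucc i) = (Pi.single (d.succAbove i) 1, 0) := fun i =>
    Fin.snoc_castSucc (α := fun _ => (Fin 4 → K) × (Fin 4 → K)) _ _ i
  have hfW : ∀ i, f i ∈ W := by
    intro i
    refine Fin.lastCases ?_ (fun i => ?_) i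
    · rw [hf_last]; exact hy
    · rw [hf_cast]; exact hmem _ (Fin.succAbove_ne d i)
  have hli : LinearIndependent K f := by
    rw [Fintype.linearIndependent_iff]
    intro g hg
    rw [Fin.sum_univ_castSucc] at hg
    simp only [hf_cast, hf_last] at hg
    -- second components: `g 3 • y.2 = 0`
    have h2 := congr_arg Prod.snd hg
    simp only [Prod.snd_add, Prod.snd_sum, Prod.smul_snd, smul_zero, Finset.sum_const_zero,
      zero_add, Prod.snd_zero] at h2
    have hg3 : g (Fin.last 3) = 0 := by
      have := congr_fun h2 i₀
      simp only [Pi.smul_apply, smul_eq_mul, Pi.zero_apply] at this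
      exact (mul_eq_zero.1 this).resolve_right hi₀
    -- first components: `Σ_{i<3} g i • e_{succAbove i} = 0`
    have h1 := congr_arg Prod.fst hg
    simp only [Prod.fst_sum, Prod.smul_fst, hg3, zero_smul, add_zero,
      Prod.fst_zero] at h1
    have hgi : ∀ i : Fin 3, g (Fin.castSucc i) = 0 := fun i => by
      have := congr_fun h1 (d.succAbove i)
      simp only [Finset.sum_apply, Pi.smul_apply, smul_eq_mul, Pi.single_apply,
        Fin.succAbove_right_inj, mul_ite, mul_one, mul_zero, Finset.sum_ite_eq,
        Finset.mem_univ, if_true, Pi.zero_apply] at this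
      exact this
    intro i
    refine Fin.lastCases ?_ (fun i => ?_) i
    · exact hg3
    · exact hgi i
  -- hence `dim W ≥ 4`
  have h4 : 4 ≤ finrank K W := by
    let f' : Fin 4 → W := fun i => ⟨f i, hfW i⟩
    have hli' : LinearIndependent K f' := by
      refine LinearIndependent.of_comp W.subtype ?_
      exact hli
    have h := hli'.fintype_card_le_finrank
    rwa [Fintype.card_fin] at h
  -- the kernel lies in the cone at `a`: one-sided, contradiction
  rcases fst_or_snd_of_four_le_diag a ha W (fun w hw l => ker_slotA_cone c t hJ a w hw l) h4
    with h | h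
  · exact hy2 (h y hy)
  · obtain ⟨j, hj⟩ : ∃ j : Fin 4, j ≠ d := ⟨d + 1, by
      intro h'; have := congr_arg (fun x : Fin 4 => x - d) h'; simp at this⟩
    have h' : (Pi.single j (1 : K) : Fin 4 → K) = 0 := h _ (hmem j hj)
    have := congr_fun h' j
    simp at this

end Summit.ValiantsHypothesis.ValiantsHypothesis.Theorems.SymPencilPerFourInnerRankMixedKillTwo

end
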